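import Summits.ResolutionOfSingularities.ResolutionOfSingularities.Theses.PAlteration
import Literature.AlgebraicGeometry.Resolution.AlterationsResolution
import Literature.AlgebraicGeometry.Resolution.AlterationsProofs
import Literature.AlgebraicGeometry.Resolution.ResolutionOfComponents
import Literature.AlgebraicGeometry.Resolution.ProjectiveSpaceRegular
import Literature.AlgebraicGeometry.Resolution.QuasiProjectiveResolution
import Literature.AlgebraicGeometry.Resolution.ResolutionProjectiveReduction

/-!
# `PalterationThesis` — negative lemmas: the crux is summit-implied; irreducibility (not
# reducedness) is what PIAlt uses; PICover without surjectivity is the summit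

Support (negative) lemmas for crux `stmt-ResolutionOfSingularities-0552`
(`Summit.ResolutionOfSingularities.ResolutionOfSingularities.Theses.PAlteration.PalterationThesis`
= `∀ p prime, PIAlt_p ∧ PICover_p`, the thesis of route pAlteration: purely inseparable regular
alterations exist — Abramovich–Oort, Temkin 2013 Conj. 1.3.1 — AND finite radicial covers of
regular varieties resolve), filed by the standing disprover (cdisprove gen 1; work file
`Cruxes/PalterationThesis/Disproof.lean`). This file declares NO definition (variants are written
out inline) and files only what the sibling crux files `Theorems/Pialt/Negative/*` (stmt-0555) and
`Theorems/Picover/Negative/*` (stmt-0554) do not already record; companions in this directory: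
`PicoverFiniteLoadBearing.lean` (`IsFinite g` is load-bearing), `PicoverContent.lean` (the
conclusion of PICover cannot be strengthened to "`X` regular").

* `not_summit_of_not_palterationThesis` — the crux is a CONSEQUENCE of the summit statement
  (PIAlt: a resolution IS a purely inseparable regular alteration,
  `IsResolution.isPurelyInseparableAlteration`, as in `Pialt.Negative.not_resolutionOfSingularities_of_not_pialt`;
  PICover: a finite radicial cover of a `k`-variety is a `k`-variety), so a refutation of the crux is a counterexample to
  resolution of singularities in positive characteristic.
* `pialt_false_without_irreducible_at` — PIAlt with `IsIntegral X` weakened to `IsReduced X ∧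
  Nonempty X` is FALSE at every prime: `Spec (𝔽_p × 𝔽_p)` (the surjective image of an integral
  scheme is irreducible). Complements the empty-scheme witness of
  `Pialt.Negative.pialt_false_without_isIntegral`: the failure is not only at `∅`.
* `pialt_iff_irreducible` — conversely REDUCEDNESS of `X` is NOT load-bearing: PIAlt at `p` is
  EQUIVALENT to its version for irreducible, possibly non-reduced `X` (compose an alteration of
  `X_red = V(√0)` — integral, `isIntegral_subscheme_vanishingIdeal` — with the closed immersion
  `X_red → X`, which is finite, radicial and a homeomorphism). So `IsIntegral X` may be replaced
  by `IrreducibleSpace X` without changing the item.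
* `picover_iff_reducedX` — in PICover `IsIntegral X` may be weakened to `IsReduced X` (a finite
  radicial surjection is a homeomorphism, so `X` is irreducible with `Y`).
* `picover_without_surjective_iff_resolutionInChar` — PICover with `Surjective g` dropped is
  LITERALLY `ResolutionInChar p` (not merely the affine case): a closed immersion is finite and
  radicial, and Chow's lemma (`ChowLemmaIntegral_holds`, proved in the tree) with projective
  closure (`exists_projectiveClosure`) gives every integral separated `X` of finite type a proper
  birational model open in an integral CLOSED subscheme of the regular integral `ℙⁿ_k`
  (`isRegular_projectiveSpace`, `isIntegral_projectiveSpace`); transport by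
  `Scheme.HasResolution.of_isOpenImmersion` / `of_isBirational`, reduced → integral by
  `hasResolution_of_forall_closeds`.

## Sources
* M. Temkin, *Inseparable local uniformization*, J. Algebra 373 (2013), §1 p. 3, Conj. 1.3.1.
* U. Görtz, T. Wedhorn, *Algebraic Geometry I*, 2nd ed., Thm. 13.100 (Chow's lemma; proved in
  the tree as `ChowLemmaIntegral_holds`), Prop. 3.27 (reduced closed subschemes).
* The Stacks Project, Tag 01S4 (radicial), Tag 01RN (birational), Tag 02IS (regular).
  Folklore reductions.
-/

noncomputable section

open CategoryTheory AlgebraicGeometry TopologicalSpace Topology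
open Literature.AlgebraicGeometry.Resolution
open Summit.ResolutionOfSingularities.ResolutionOfSingularities.Theses.PAlteration

set_option linter.dupNamespace false

namespace Summit.ResolutionOfSingularities.ResolutionOfSingularities.Theorems.PalterationThesis.Negative

/-! ## The crux is summit-implied -/

/-- **A kill of the crux `PalterationThesis` is a counterexample to resolution of singularities
in positive characteristic**: the summit implies PIAlt (a resolution IS a purely inseparable
regular alteration, `IsResolution.isPurelyInseparableAlteration`; cf. the sibling file
`Theorems/Pialt/Negative/LoadBearing.lean`) and PICover (the cover
`X` is itself a reduced separated `k`-scheme of finite type via `g ≫ f`). Stated negatively on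
purpose (this file credits no positive item). [folklore] -/
theorem not_summit_of_not_palterationThesis (h : ¬ PalterationThesis) :
    ¬ _root_.ResolutionOfSingularities := fun hs =>
  h fun p hp => ⟨fun k _ _ X f hs' hl hq hi => by
      obtain ⟨Y, φ, hφ, hreg⟩ := abramovichOort_of_resolutionInChar (hs p hp) k X f
      obtain ⟨U, hU, hfin, hui⟩ := hφ.exists_dense
      haveI := hφ.surjective
      exact ⟨Y, φ, hφ.isProper, hφ.isIntegral, hreg, φ.surjective, U, hU, hfin, hui⟩,
    fun k _ _ Y X f g _ _ _ _ _ _ _ _ _ =>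
      hs p hp k X (g ≫ f) inferInstance inferInstance inferInstance inferInstance⟩

/-! ## PIAlt: irreducibility is load-bearing, reducedness is not -/

/-- `K × K` is not a domain. [folklore] -/
theorem not_isDomain_prod (K : Type) [Field K] : ¬ IsDomain (K × K) := by
  intro h
  have : ((1, 0) : K × K) * (0, 1) = 0 := by simp
  rcases mul_eq_zero.mp this with h1 | h1 <;> simp at h1

/-- **PIAlt with `IsIntegral X` weakened to `IsReduced X ∧ Nonempty X` fails at
`Spec (𝔽_p × 𝔽_p)`**, at every prime: the image of the integral `X'` under the surjection `g`
would be irreducible, making `𝔽_p × 𝔽_p` a domain. IRREDUCIBILITY of `X` is what any proof of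
PIAlt must use. [folklore] -/
theorem pialt_false_without_irreducible_at (p : ℕ) [Fact p.Prime] :
    ¬ ∀ (k : Type) [Field k] [CharP k p] (X : Scheme.{0}) (f : X ⟶ Spec (.of k)),
        IsSeparated f → LocallyOfFiniteType f → QuasiCompact f → IsReduced X → Nonempty X →
          ∃ (X' : Scheme.{0}) (g : X' ⟶ X), IsProper g ∧ IsIntegral X' ∧ Scheme.IsRegular X' ∧
            Function.Surjective g.base ∧ ∃ U : X.Opens, Dense (U : Set X) ∧ IsFinite (g ∣_ U) ∧
              UniversallyInjective (g ∣_ U) := by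
  intro h
  let f : Spec (.of (ZMod p × ZMod p)) ⟶ Spec (.of (ZMod p)) :=
    Spec.map (CommRingCat.ofHom (algebraMap (ZMod p) (ZMod p × ZMod p)))
  haveI : LocallyOfFiniteType f :=
    (HasRingHomProperty.Spec_iff (P := @LocallyOfFiniteType)).mpr
      (RingHom.finiteType_algebraMap.mpr inferInstance)
  haveI : Nonempty (Spec (.of (ZMod p × ZMod p))) :=
    ⟨⟨Ideal.comap (RingHom.fst (ZMod p) (ZMod p)) ⊥, Ideal.comap_isPrime _ _⟩⟩
  obtain ⟨X', g, -, hint, -, hsurj, -⟩ := h (ZMod p) (Spec (.of (ZMod p × ZMod p))) f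
    inferInstance inferInstance inferInstance inferInstance inferInstance
  haveI : IrreducibleSpace (Spec (.of (ZMod p × ZMod p))) :=
    hsurj.irreducibleSpace g.base.hom.continuous
  have hi : IsIntegral (Spec (.of (ZMod p × ZMod p))) :=
    isIntegral_of_irreducibleSpace_of_isReduced _
  exact not_isDomain_prod (ZMod p) ((affine_isIntegral_iff (.of (ZMod p × ZMod p))).mp hi)

open Scheme.IdealSheafData in
/-- **Reducedness of `X` is NOT load-bearing in PIAlt; irreducibility is the whole of
`IsIntegral X`.** PIAlt at `p` is equivalent to its version for IRREDUCIBLE (possibly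
non-reduced) `X`: compose a purely inseparable regular alteration of `X_red` (the reduced closed
subscheme on `⊤`, integral) with the closed immersion `X_red → X`, which is finite, radicial and a
homeomorphism. [folklore] -/
theorem pialt_iff_irreducible (p : ℕ) :
    (∀ (k : Type) [Field k] [CharP k p] (X : Scheme.{0}) (f : X ⟶ Spec (.of k)),
        IsSeparated f → LocallyOfFiniteType f → QuasiCompact f → IsIntegral X →
          ∃ (X' : Scheme.{0}) (g : X' ⟶ X), IsProper g ∧ IsIntegral X' ∧ Scheme.IsRegular X' ∧
            Function.Surjective g.base ∧ ∃ U : X.Opens, Dense (U : Set X) ∧ IsFinite (g ∣_ U) ∧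
              UniversallyInjective (g ∣_ U)) ↔
    (∀ (k : Type) [Field k] [CharP k p] (X : Scheme.{0}) (f : X ⟶ Spec (.of k)),
        IsSeparated f → LocallyOfFiniteType f → QuasiCompact f → IrreducibleSpace X →
          ∃ (X' : Scheme.{0}) (g : X' ⟶ X), IsProper g ∧ IsIntegral X' ∧ Scheme.IsRegular X' ∧
            Function.Surjective g.base ∧ ∃ U : X.Opens, Dense (U : Set X) ∧ IsFinite (g ∣_ U) ∧
              UniversallyInjective (g ∣_ U)) := by
  refine ⟨fun h k _ _ X f hs hl hq hirr => ?_, fun h k _ _ X f hs hl hq hi => h k X f hs hl hq inferInstance⟩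
  -- the reduced structure on `X`
  let ι := (vanishingIdeal (⊤ : Closeds X)).subschemeι
  haveI hint : IsIntegral (vanishingIdeal (⊤ : Closeds X)).subscheme :=
    isIntegral_subscheme_vanishingIdeal ⊤ (by
      simpa using IrreducibleSpace.isIrreducible_univ X)
  obtain ⟨X', g', hg', hint', hreg', hsurj', U', hU', hfin', hui'⟩ :=
    h k _ (ι ≫ f) inferInstance inferInstance inferInstance hint
  haveI := hg'
  -- `ι` is a surjective closed immersion, hence a homeomorphism
  have hrange : Set.range ι = (Set.univ : Set X) := by
    have h1 := range_subschemeι_vanishingIdeal (X := X) (⊤ : Closeds X)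
    rw [TopologicalSpace.Closeds.coe_top] at h1
    exact h1
  have hιsurj : Function.Surjective ι.base := Set.range_eq_univ.mp hrange
  have hhomeo : IsHomeomorph ι.base :=
    isHomeomorph_iff_continuous_isClosedMap_bijective.mpr
      ⟨ι.continuous, ι.isClosedMap, ι.isClosedEmbedding.injective, hιsurj⟩
  let U : X.Opens := ⟨ι.base '' (U' : Set _), hhomeo.isOpenMap _ U'.isOpen⟩
  have hUpre : ι ⁻¹ᵁ U = U' := by
    ext1
    exact Set.preimage_image_eq _ ι.isClosedEmbedding.injective
  refine ⟨X', g' ≫ ι, inferInstance, hint', hreg', ?_, U, ?_, ?_, ?_⟩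
  · intro x
    obtain ⟨y, rfl⟩ := hιsurj x
    obtain ⟨z, rfl⟩ := hsurj' y
    exact ⟨z, by simp⟩
  · refine U.isOpen.dense ?_
    obtain ⟨y, hy⟩ := hU'.nonempty
    exact ⟨ι.base y, y, hy, rfl⟩
  · have hfinU : IsFinite (g' ∣_ ι ⁻¹ᵁ U) := by rw [hUpre]; exact hfin'
    have hfinι : IsFinite (ι ∣_ U) := inferInstance
    rw [morphismRestrict_comp]
    exact MorphismProperty.comp_mem _ _ _ hfinU hfinι
  · have huiU : UniversallyInjective (g' ∣_ ι ⁻¹ᵁ U) := by rw [hUpre]; exact hui'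
    have huiι : UniversallyInjective (ι ∣_ U) := MorphismProperty.of_isPullback
      (isPullback_morphismRestrict ι U).flip inferInstance
    rw [morphismRestrict_comp]
    exact MorphismProperty.comp_mem _ _ _ huiU huiι

/-! ## PICover: `IsIntegral X` ↦ `IsReduced X`; surjectivity dropped is the summit -/

/-- **In PICover, `IsIntegral X` may be weakened to `IsReduced X`** (but not dropped: the
sibling crux file `Theorems/Picover` records the non-reduced witness `Spec 𝔽_p[ε] → Spec 𝔽_p`): a finite universally injective surjection is a
homeomorphism, so `X` is irreducible with `Y`. [folklore] -/
theorem picover_iff_reducedX (p : ℕ) :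
    (∀ (k : Type) [Field k] [CharP k p] (Y X : Scheme.{0}) (f : Y ⟶ Spec (.of k)) (g : X ⟶ Y),
        IsSeparated f → LocallyOfFiniteType f → QuasiCompact f → IsIntegral Y →
          Scheme.IsRegular Y → IsIntegral X → IsFinite g → UniversallyInjective g →
            Function.Surjective g.base → Scheme.HasResolution X) ↔
    (∀ (k : Type) [Field k] [CharP k p] (Y X : Scheme.{0}) (f : Y ⟶ Spec (.of k)) (g : X ⟶ Y),
        IsSeparated f → LocallyOfFiniteType f → QuasiCompact f → IsIntegral Y →
          Scheme.IsRegular Y → IsReduced X → IsFinite g → UniversallyInjective g →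
            Function.Surjective g.base → Scheme.HasResolution X) := by
  refine ⟨fun h k _ _ Y X f g hs hl hq hiY hreg hred hfin hui hsurj => ?_,
    fun h k _ _ Y X f g hs hl hq hiY hreg hiX hfin hui hsurj =>
      h k Y X f g hs hl hq hiY hreg inferInstance hfin hui hsurj⟩
  have hhomeo : IsHomeomorph g.base :=
    isHomeomorph_iff_continuous_isClosedMap_bijective.mpr
      ⟨g.continuous, g.isClosedMap, g.injective, hsurj⟩
  haveI : IrreducibleSpace X := (hhomeo.homeomorph).irreducibleSpace_iff.mpr inferInstance
  haveI : IsIntegral X := isIntegral_of_irreducibleSpace_of_isReduced X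
  exact h k Y X f g hs hl hq hiY hreg inferInstance hfin hui hsurj

open Scheme.IdealSheafData in
/-- **`Picover` with `Function.Surjective g.base` dropped is LITERALLY `ResolutionInChar p`**: a
closed immersion is finite and radicial, and by Chow's lemma (`ChowLemmaIntegral_holds`) plus
projective closure (`exists_projectiveClosure`) every integral separated `X` of finite type over
`k` has a proper birational model that is an open subscheme of an integral CLOSED subscheme of
the regular integral `ℙⁿ_k` (`isRegular_projectiveSpace`, `isIntegral_projectiveSpace`);
resolutions transport back (`Scheme.HasResolution.of_isOpenImmersion`,
`Scheme.HasResolution.of_isBirational`). Surjectivity is what confines `Picover` to radicial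
COVERS. [folklore] -/
theorem picover_without_surjective_iff_resolutionInChar (p : ℕ) :
    (∀ (k : Type) [Field k] [CharP k p] (Y X : Scheme.{0}) (f : Y ⟶ Spec (.of k)) (g : X ⟶ Y),
        IsSeparated f → LocallyOfFiniteType f → QuasiCompact f → IsIntegral Y →
          Scheme.IsRegular Y → IsIntegral X → IsFinite g → UniversallyInjective g →
            Scheme.HasResolution X) ↔
    ResolutionInChar.{0} p := by
  constructor
  · intro h k _ _ X f hs hl hq hred
    refine hasResolution_of_forall_closeds X f fun Z hZ => ?_
    haveI := hZ
    obtain ⟨n, X', π, ι, hint', hι, hπ, -, -, U, hU, hU', hiso⟩ :=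
      ChowLemmaIntegral_holds k _ ((vanishingIdeal Z).subschemeι ≫ f) inferInstance inferInstance
        inferInstance hZ
    haveI := hint'
    haveI := hι
    haveI := hπ
    obtain ⟨Xbar, j, c, hXbar, hj, hc, -, -⟩ := exists_projectiveClosure ι
    haveI := hj
    haveI := hc
    haveI : IsProper (Literature.AlgebraicGeometry.Motives.projectiveSpace n k).hom :=
      Literature.AlgebraicGeometry.Motives.isProper_projectiveSpace n k
    have hbar : Scheme.HasResolution Xbar :=
      h k _ Xbar (Literature.AlgebraicGeometry.Motives.projectiveSpace n k).hom c inferInstance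
        inferInstance inferInstance (isIntegral_projectiveSpace n k) (isRegular_projectiveSpace n k)
        hXbar inferInstance inferInstance
    exact Scheme.HasResolution.of_isBirational π ⟨U, hU, hU', hiso⟩ (hbar.of_isOpenImmersion j)
  · intro h k _ _ Y X f g hs hl hq _ _ _ hfin hui
    exact h k X (g ≫ f) inferInstance inferInstance inferInstance inferInstance


end Summit.ResolutionOfSingularities.ResolutionOfSingularities.Theorems.PalterationThesis.Negative

end
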